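import Literature.Claims.NS.Chishtie2025
import Literature.Analysis.FluidPDE.VorticityCalculus
import Literature.Analysis.FluidPDE.VectorCalculusProofs
import Literature.Analysis.FluidPDE.SpaceTimeCalculus
import Literature.Analysis.FluidPDE.NSSuitableESSRefutation
import HarnessLib

/-!
# C37 `Chishtie2025` — kernel refutations: the convection decomposition (20), Lemmas 5.2 / 5.3,
# the displayed inequalities (107) / (112), and Theorem 5.5 itself (the quaternionic system (76))

D-0090 NS-CLAIMS sweep, row C37: F. A. Chishtie, *A unified quaternion-complex framework for
Navier-Stokes equations: new insights and implications* (arXiv 2505.22853 **v3**, 2025-06-08; PDF page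
= print page). Skeleton `Literature.Claims.NS.Chishtie2025` (p479900, typist-6 g2). Refuter of record
refuter-2 (RULINGS v1.29h (3)). Credit: the shear machinery and the theorems `not_Step1_Convection20`,
`not_Step5_Lemma52` are ns-claims-typist-6 g2's QC draft v1 (sha16 9a961bb49ffa39ae), adopted with
docstrings; the witnesses behind `not_Step7_Lemma53` and `not_Step9_Ineq107_abs` were named first by
typist-6 g2 (kernel-draft lines 01:07Z–01:23Z, draft v3 315f42f8016466b6; the proofs below are written
independently); the Step 12 witness, the Navier–Stokes-slice theorem and the Theorem 5.5 kill are
refuter-2's. Filed under cell convention (b) by a salvage seat, unchanged.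

## Locators and witnesses

* **Step 1** = `Step1_Convection20` = (20), §4.2 p.7: «(u·∇)Q = Q ⋆ ∇_Q Q + Q̄ ⋆ ∇_Q̄ Q» — the identity
  by which the «quaternion Navier–Stokes system» (21)–(22) p.7 = (76)–(77) p.13 is Navier–Stokes at all,
  and the content of the transfer in the proof of Cor 5.6 p.17 (kernel: `cor56_of_thm55`). FALSE on the
  plane shear `u(x) = (x₁, 0, 0)` (print `u = (y, 0, 0)`, `Q = y i`): `(u·∇)Q = 0`, `Q ⋆ ∇_Q Q + Q̄ ⋆ ∇_Q̄ Q
  = 2y j` (`not_Step1_Convection20`). The shear is an exact steady solution of the classical system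
  (118)–(119) (`isClassicalNSSolutionOn_shear`), so the charitable retype «(20) only along Navier–Stokes
  solutions» fails too (`step1_step5_fail_along_navierStokes`).
* **Step 5** = `Step5_Lemma52` = Lemma 5.2 (72) p.12 = (88) p.14: same shear, `2y² ≠ y²` (`not_Step5_Lemma52`).
* **Step 7** = `Step7_Lemma53` = Lemma 5.3 p.12 (Leibniz rule for `∇_Q^s(A ⋆ B)`), used at (98)–(100) p.15:
  FALSE at `s = 1`, `A ≡ i`, `B = Q_shear`: `∇_Q(i ⋆ B) = −j` but `i ⋆ ∇_Q B + (∇_Q i) ⋆ B = j` — the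
  units inside `∇_Q` act on the left and do not commute with `A` (`not_Step7_Lemma53`).
* **Step 9** = `Step9_Ineq107_abs`, p.15, (97) ∧ (100)·(103)·(104) ∧ (105) ⇒ (107) at the grain of the
  displayed real inequalities: FALSE — `ν = λ = C₁ = 1`, `C₂ = 0`, `X = t²`, `A = t`, `D = t²`, `N = −t⁴`,
  `E' = 0` satisfy every displayed hypothesis and (107) reads `t⁴/2 ≤ C t²` (`not_Step9_Ineq107_abs`).
* **Step 12** = `Step12_Ineq112_abs`, p.16 (111)–(113) («from (85): ‖∇Q(t)‖² ≤ ‖∇Q(0)‖²»): FALSE —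
  `E(t) = 1 − t²`, `G(t) = t`, `ν = 1` on `[0,1]` satisfy (85)/(86), yet `G(1) > G(0)` (`not_Step12_Ineq112_abs`).
* **Theorem 5.5 itself** (`Thm55`, p.13; first conjunct of `ClaimedTheorem`): FALSE as printed and typed.
  The real part of (76) is a hidden scalar constraint on the velocity alone — `Re(Q ⋆ ∇_Q Q + Q̄ ⋆ ∇_Q̄ Q)
  = −2 u·(e_y × ∂_y u + e_z × ∂_z u)` must vanish, the other terms of (76) being purely imaginary
  (`re_qnonlin_eq_zero`) — and the smooth compactly supported divergence-free datum `u₀ = curl(χ A)`,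
  `A = (0, x₀x₁, x₁)`, `χ` a bump equal to `1` near the origin (so `u₀ = (1, 0, x₁)` there), violates it at
  the origin: `Re(…)(0) = −2` (`re_qnonlin_datum`). Hence NO solution of (76)–(77) on `[0, ∞)` (indeed on
  any time set containing `0`) has `u(0) = u₀`: `not_Thm55`; `not_ClaimedTheorem` through this first
  conjunct ONLY — nothing whatsoever is said about Corollary 5.6 / the Navier–Stokes equations.

CLASS (refuter's reading; the referee decides): false lemma (countermodel) at Step 1 (20) p.7, the first
step in dependency order, consumed in the kernel by `cor56_of_thm55`; alongside: Lemmas 5.2, 5.3, (107),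
(112) false at their displayed grain; Theorem 5.5 false as a statement about the system (76)–(77) (Δ2:
with (20) false that system is not Navier–Stokes, and it is overdetermined).

WHAT THIS IS NOT: not a claim about NS regularity or blow-up; not a claim about any author beyond
the typed locator.
-/

set_option linter.dupNamespace false

open Set Function MeasureTheory WithLp Filter Topology Metric
open scoped ContDiff Quaternion Laplacian
open Literature.Claims.NS.Chishtie2025 Literature.Analysis.FluidPDE Literature.Analysis.FluidPDE.Tao2016

noncomputable section

namespace Summit.NavierStokesRegularity.NavierStokesRegularity.Theorems.Chishtie2025

/-! ## The plane shear `u(x) = (x₁, 0, 0)` (typist-6 g2's QC kit, adopted) -/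

/-- The shear `u(x) = (x₁, 0, 0)` (print p.7 coordinates: `u = (y, 0, 0)`, `Q = y i`). -/
def shear (x : E3) : E3 := toLp 2 ![x 1, 0, 0]

/-- The shear as a continuous linear map. -/
def shearL : E3 →L[ℝ] E3 :=
  LinearMap.toContinuousLinearMap
    { toFun := shear
      map_add' := fun v w => by ext i; fin_cases i <;> simp [shear]
      map_smul' := fun c v => by ext i; fin_cases i <;> simp [shear] }

/-- `shearL x = shear x`. -/
@[simp] theorem shearL_apply (x : E3) : shearL x = shear x := rfl
/-- The shear is its own derivative. -/
theorem hasFDerivAt_shear (x : E3) : HasFDerivAt shear shearL x := shearL.hasFDerivAt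
/-- The shear is smooth. -/
theorem contDiff_shear : ContDiff ℝ ∞ shear := shearL.contDiff

/-- The shear is divergence free. -/
theorem shear_divFree : NSWave0.IsDivFree shear := by
  intro x
  show VectorCalculus.divergence shear x = 0
  rw [divergence_eq_sum_inner_fderiv (EuclideanSpace.basisFun (Fin 3) ℝ), (hasFDerivAt_shear x).fderiv]
  simp [Fin.sum_univ_three, shear, EuclideanSpace.inner_single_left]

/-- `∂_j Q` for the shear: `∂_j Q(x) = quatOf (shear e_j)`. -/
theorem pd_shear (j : Fin 3) (x : E3) : pd j (Qf shear) x = quatOf (shear (e j)) :=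
  pd_Qf (hasFDerivAt_shear x) j

/-- `shear e₀ = 0`. -/
theorem shear_e0 : shear (e 0) = 0 := by ext i; fin_cases i <;> simp [shear, e]
/-- `shear e₁ = e₀`. -/
theorem shear_e1 : shear (e 1) = e 0 := by ext i; fin_cases i <;> simp [shear, e]
/-- `shear e₂ = 0`. -/
theorem shear_e2 : shear (e 2) = 0 := by ext i; fin_cases i <;> simp [shear, e]
/-- `(e₁)₁ = 1`. -/
theorem e1_one : (e 1 : E3) 1 = 1 := by simp [e]

/-- `quatOf e₀ = i`. -/
theorem quatOf_e0 : quatOf (e 0) = qi := by ext <;> simp [quatOf, e, qi]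
/-- `quatOf e₂ = k`. -/
theorem quatOf_e2 : quatOf (e 2) = qk := by ext <;> simp [quatOf, e, qk]
/-- `Q_shear(x) = x₁ i`. -/
theorem quatOf_shear (x : E3) : quatOf (shear x) = (x 1) • qi := by ext <;> simp [quatOf, shear, qi]
/-- `quatOf 0 = 0`. -/
theorem quatOf_zero' : quatOf (0 : E3) = 0 := by ext <;> simp [quatOf]

/-- `∇_Q Q_shear = j ⋆ i = −k`. -/
theorem nablaQ_shear (x : E3) : nablaQ (Qf shear) x = -qk := by
  simp only [nablaQ, pd_shear, shear_e0, shear_e1, shear_e2, quatOf_e0, quatOf_zero']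
  ext <;> simp [qi, qj, qk]
/-- `∇_Q̄ Q_shear = −j ⋆ i = k`. -/
theorem nablaQbar_shear (x : E3) : nablaQbar (Qf shear) x = qk := by
  simp only [nablaQbar, pd_shear, shear_e0, shear_e1, shear_e2, quatOf_e0, quatOf_zero']
  ext <;> simp [qi, qj, qk]

/-- `Q ⋆ ∇_Q Q + Q̄ ⋆ ∇_Q̄ Q = 2x₁ j` for the shear. -/
theorem qnonlin_shear (x : E3) : qnonlin shear x = (2 * x 1) • qj := by
  simp only [qnonlin, Qf, nablaQ_shear, nablaQbar_shear, quatOf_shear]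
  ext <;> simp [qi, qj, qk]; ring

/-- `(u·∇)u = 0` for the shear. -/
theorem convect_shear (x : E3) : convect shear shear x = 0 := by
  rw [convect_apply, (hasFDerivAt_shear x).fderiv, shearL_apply]
  ext i; fin_cases i <;> simp [shear]

/-- (20) fails for the shear at `x = e₁`: LHS `= 0`, RHS `= 2 j`. -/
theorem convection20_fails_at_shear : quatOf (convect shear shear (e 1)) ≠ qnonlin shear (e 1) := by
  intro h1
  rw [convect_shear, quatOf_zero', qnonlin_shear, e1_one] at h1
  have h2 := congrArg (fun q : ℍ => q.imJ) h1
  simp [qj] at h2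

/-- **Step 1 — (20) p.7 fails on the shear at `x = e₁`: LHS `= 0`, RHS `= 2 j`.** (typist-6 g2's kit) -/
theorem not_Step1_Convection20 : ¬ Literature.Claims.NS.Chishtie2025.Step1_Convection20 :=
  fun h => convection20_fails_at_shear (h shear contDiff_shear shear_divFree (e 1))

/-- (72) fails for the shear at `x = e₁`: LHS `= 2`, RHS `= 1`. -/
theorem lemma52_fails_at_shear :
    ‖Qf shear (e 1) * nablaQ (Qf shear) (e 1)‖ ^ 2 + ‖star (Qf shear (e 1)) * nablaQbar (Qf shear) (e 1)‖ ^ 2 ≠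
      ‖Qf shear (e 1)‖ ^ 2 * gradNormSq (Qf shear) (e 1) := by
  intro h1
  -- `|q|² = re² + imI² + imJ² + imK²` (= `Literature.MathematicalPhysics.QuantumLattice.sq_norm_eq_sum_sq`,
  -- restated locally to keep the import list small)
  have norm_sq_quat : ∀ q : ℍ, ‖q‖ ^ 2 = q.re ^ 2 + q.imI ^ 2 + q.imJ ^ 2 + q.imK ^ 2 := fun q => by
    rw [sq, ← Quaternion.normSq_eq_norm_mul_self, Quaternion.normSq_def']
  have hgrad : gradNormSq (Qf shear) (e 1) = 1 := by
    simp only [gradNormSq, pd_shear, Fin.sum_univ_three, shear_e0, shear_e1, shear_e2, quatOf_e0,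
      quatOf_zero', norm_sq_quat]
    simp [qi]
  rw [hgrad, nablaQ_shear, nablaQbar_shear] at h1
  simp only [Qf, quatOf_shear, e1_one, one_smul, norm_sq_quat] at h1
  simp [qi, qk] at h1

/-- **Step 5 — Lemma 5.2 (72) p.12 = (88) p.14 fails on the shear at `x = e₁`: LHS `= 2`, RHS `= 1`.**
(typist-6 g2's kit) -/
theorem not_Step5_Lemma52 : ¬ Literature.Claims.NS.Chishtie2025.Step5_Lemma52 :=
  fun h => lemma52_fails_at_shear (h shear contDiff_shear (e 1))

/-! ## Step 1 / Step 5 along an exact Navier–Stokes solution (the charitable retype «slices only») -/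

/-- **The shear is an exact steady solution of the classical Navier–Stokes system (118)–(119)** with zero
pressure and zero force, for every viscosity (plane Couette flow: `∂ₜu = 0`, `(u·∇)u = 0`, `Δu = 0`,
`div u = 0`), on the whole time axis. -/
theorem isClassicalNSSolutionOn_shear (ν : ℝ) :
    IsClassicalNSSolutionOn univ ν 0 (fun _ : ℝ => shear) (fun (_ : ℝ) (_ : E3) => (0 : ℝ)) where
  smooth_velocity := isSmoothSpaceTimeOn_const_time contDiff_shear univ
  smooth_pressure := isSmoothSpaceTimeOn_const_time contDiff_const univ
  momentum t _ x := by
    have hcoe : (shearL : E3 → E3) = shear := rfl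
    have hΔ : (Δ shear) x = 0 := by rw [← hcoe]; exact laplacian_clm_apply shearL x
    have ht : timeDerivWithin univ (fun _ : ℝ => shear) t x = 0 := by simp [timeDerivWithin]
    beta_reduce
    rw [ht, convect_shear, hΔ]
    simp
  divFree t _ := shear_divFree

/-- **(20) and (72) fail along a Navier–Stokes solution**: there is an exact classical solution of
(118)–(119) (zero force) a velocity slice of which violates both the convection decomposition (20) p.7 and
the «energy constraint» (72)/(88) at some point — so restricting Step 1 / Step 5 to Navier–Stokes velocity
fields does not rescue them. -/
theorem step1_step5_fail_along_navierStokes : ∃ (ν : ℝ) (u : ℝ → E3 → E3) (p : ℝ → E3 → ℝ),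
    0 < ν ∧ IsClassicalNSSolutionOn univ ν 0 u p ∧ ∃ t x,
      quatOf (convect (u t) (u t) x) ≠ qnonlin (u t) x ∧
      ‖Qf (u t) x * nablaQ (Qf (u t)) x‖ ^ 2 + ‖star (Qf (u t) x) * nablaQbar (Qf (u t)) x‖ ^ 2 ≠
        ‖Qf (u t) x‖ ^ 2 * gradNormSq (Qf (u t)) x :=
  ⟨1, fun _ => shear, fun _ _ => 0, one_pos, isClassicalNSSolutionOn_shear 1, 0, e 1,
    convection20_fails_at_shear, lemma52_fails_at_shear⟩

/-! ## Step 7 — Lemma 5.3 (the quaternion Leibniz rule) is false at `s = 1` -/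

/-- `∇_Q` of a constant field vanishes. -/
theorem nablaQ_const (q : ℍ) (x : E3) : nablaQ (fun _ : E3 => q) x = 0 := by
  simp [nablaQ, pd]

/-- `∇_Q (i ⋆ Q_shear) = j ⋆ (i ⋆ i) = −j`. -/
theorem nablaQ_qi_mul_Qf_shear (x : E3) : nablaQ (fun y => qi * Qf shear y) x = -qj := by
  have hpd : ∀ j : Fin 3, pd j (fun y => qi * Qf shear y) x = qi * quatOf (shear (e j)) := by
    intro j
    rw [pd, ((hasFDerivAt_Qf (hasFDerivAt_shear x)).const_mul qi).fderiv]
    simp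
  simp only [nablaQ, hpd, shear_e0, shear_e1, shear_e2, quatOf_e0, quatOf_zero']
  ext <;> simp [qi, qj, qk]

/-- **Step 7 — Lemma 5.3 p.12 fails at `s = 1`, `A ≡ i`, `B = Q_shear`:** `∇_Q(A ⋆ B) = −j` whereas the
printed right-hand side `A ⋆ ∇_Q B + (∇_Q A) ⋆ B = i ⋆ (−k) + 0 = j` (the units of `∇_Q` act on the LEFT of
the product and do not commute with `A`). -/
theorem not_Step7_Lemma53 : ¬ Literature.Claims.NS.Chishtie2025.Step7_Lemma53 := by
  intro h
  have hB : ContDiff ℝ ∞ (Qf shear) := by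
    show ContDiff ℝ ∞ fun x => quatOfL (shear x)
    exact quatOfL.contDiff.comp contDiff_shear
  have h1 := h 1 (fun _ => qi) (Qf shear) contDiff_const hB (e 1)
  simp only [nablaQPow, Nat.sub_zero, Nat.sub_self, Function.iterate_one, Function.iterate_zero, id_eq,
    Finset.sum_range_succ, Finset.sum_range_zero, zero_add, Nat.choose_zero_right, Nat.choose_self,
    Nat.cast_one, one_smul, nablaQ_qi_mul_Qf_shear, nablaQ_const, nablaQ_shear, zero_mul, add_zero] at h1
  have h2 := congrArg (fun q : ℍ => q.imJ) h1
  norm_num [qi, qj, qk] at h2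

/-! ## Steps 9 and 12 — the displayed real inequalities (107) and (112) -/

/-- **Step 9 — the passage to (107) p.15 is false at the grain of the displays:** with `ν = λ = C₁ = 1`,
`C₂ = 0` and, for a candidate constant `C`, the values `t = |C| + 2`, `X = t²`, `A = t`, `D = t²`, `N = −t⁴`,
`E' = 0`, the hypotheses (97), (100)·(103)·(104), (105) all hold and (107) reads `t⁴/2 ≤ C t²`. -/
theorem not_Step9_Ineq107_abs : ¬ Literature.Claims.NS.Chishtie2025.Step9_Ineq107_abs := by
  intro h
  obtain ⟨C, hC⟩ := h 1 1 1 0 one_pos one_pos zero_le_one le_rfl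
  set t : ℝ := |C| + 2 with ht
  have habs : 0 ≤ |C| := abs_nonneg C
  have ht2 : 2 ≤ t := by rw [ht]; linarith
  have ht0 : 0 ≤ t := by linarith
  have hsq : Real.sqrt (t ^ 2) = t := Real.sqrt_sq ht0
  have key := hC 0 (t ^ 2) t (t ^ 2) (-(t ^ 4)) (by positivity) ht0 le_rfl (by ring) ?_ ?_
  · have hCt : C * t ^ 2 < t ^ 2 / 2 * t ^ 2 := by
      apply mul_lt_mul_of_pos_right _ (by positivity)
      calc C ≤ |C| := le_abs_self C
        _ < t ^ 2 / 2 := by nlinarith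
    nlinarith
  · rw [abs_neg, abs_of_nonneg (by positivity), hsq]
    nlinarith
  · have h1t : 1 ≤ t ^ 2 := by nlinarith
    have hmul : t ^ 2 * 1 ≤ t ^ 2 * t ^ 2 := mul_le_mul_of_nonneg_left h1t (by positivity)
    calc 1 * 1 * t ^ 2 = t ^ 2 * 1 := by ring
      _ ≤ t ^ 2 * t ^ 2 := hmul
      _ = 1 * (t ^ 2) ^ 2 := by ring

/-- **Step 12 — the «energy barrier» inference (111)–(113) p.16 is false at the grain of the display:**
`E(t) = 1 − t²`, `G(t) = t`, `ν = 1` on `[0, 1]` satisfy the energy balance (85) in differential and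
integrated form with `E, G ≥ 0`, `G` continuous, yet `G(1) = 1 > 0 = G(0)`. -/
theorem not_Step12_Ineq112_abs : ¬ Literature.Claims.NS.Chishtie2025.Step12_Ineq112_abs := by
  intro h
  have hderiv : ∀ t : ℝ, HasDerivAt (fun s : ℝ => 1 - s ^ 2) (-(2 * 1 * t)) t := by
    intro t
    have h2 : HasDerivAt (fun s : ℝ => s ^ 2) (2 * t) t := by simpa using hasDerivAt_pow 2 t
    simpa using h2.const_sub 1
  have hint : ∀ t : ℝ, (1 - t ^ 2) + 2 * 1 * ∫ τ in (0 : ℝ)..t, τ = 1 - 0 ^ 2 := by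
    intro t
    rw [integral_id]
    ring
  have key := h 1 1 (fun s => 1 - s ^ 2) (fun s => s) one_pos one_pos
    (fun t ht => by nlinarith [ht.1, ht.2]) (fun t ht => ht.1) continuous_id
    (fun t _ => hderiv t) (fun t _ => hint t) 1 ⟨zero_le_one, le_rfl⟩
  norm_num at key

/-! ## Theorem 5.5 is false: the real part of (76) is a hidden constraint on the velocity -/

/-- **The hidden scalar constraint of (76).** For a solution of the quaternionic system (76)–(77) in the
typed sense, `Re(Q ⋆ ∇_Q Q + Q̄ ⋆ ∇_Q̄ Q) = 0` at every time of the time set and every point: the three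
other terms of (76) (`∂ₜQ`, `∇_Q p = quatOf ∇p`, `ν∇²Q`) are purely imaginary. (In coordinates
`Re(…) = −2 u·(e_y × ∂_y u + e_z × ∂_z u)`, which does not vanish for a general divergence-free field.) -/
theorem re_qnonlin_eq_zero {S : Set ℝ} {ν ρ : ℝ} {u : ℝ → E3 → E3} {p : ℝ → E3 → ℝ}
    (h : IsQNSSolutionOn S ν ρ u p) {t : ℝ} (ht : t ∈ S) (x : E3) : (qnonlin (u t) x).re = 0 := by
  have hm := congrArg (fun q : ℍ => q.re) (h.momentum t ht x)
  simpa using hm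

/-- Cut-off: a smooth bump equal to `1` on the closed unit ball, supported in the ball of radius `2`. -/
def χ : ContDiffBump (0 : E3) := ⟨1, 2, one_pos, by norm_num⟩
/-- Coordinate projections `x ↦ xᵢ` as continuous linear maps. -/
def P (i : Fin 3) : E3 →L[ℝ] ℝ := EuclideanSpace.proj i
/-- `P i x = xᵢ`. -/
@[simp] theorem P_apply (i : Fin 3) (x : E3) : P i x = x i := rfl
/-- The polynomial vector potential `A(x) = (0, x₀x₁, x₁)`. -/
def Apot (x : E3) : E3 := (x 0 * x 1) • e 1 + (x 1) • e 2
/-- Its curl, `V(x) = (1, 0, x₁)`. -/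
def Vfield (x : E3) : E3 := e 0 + (x 1) • e 2
/-- `DV`, the constant linear map `h ↦ h₁ e₂`. -/
def VL : E3 →L[ℝ] E3 := (P 1).smulRight (e 2)
/-- **The datum** `u₀ = curl (χ A)`: smooth, compactly supported, divergence free, equal to `(1, 0, x₁)` on
the unit ball. -/
def datum : E3 → E3 := curl fun x => χ x • Apot x

/-- `A` is smooth. -/
theorem contDiff_Apot : ContDiff ℝ ∞ Apot := by
  show ContDiff ℝ ∞ fun x => (P 0 x * P 1 x) • e 1 + (P 1 x) • e 2
  exact (((P 0).contDiff.mul (P 1).contDiff).smul contDiff_const).add ((P 1).contDiff.smul contDiff_const)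

/-- The derivative of `A`. -/
theorem hasFDerivAt_Apot (y : E3) :
    HasFDerivAt Apot ((P 0 y • P 1 + P 1 y • P 0).smulRight (e 1) + (P 1).smulRight (e 2)) y := by
  show HasFDerivAt (fun x => (P 0 x * P 1 x) • e 1 + (P 1 x) • e 2) _ y
  exact (((P 0).hasFDerivAt.mul (P 1).hasFDerivAt).smul_const (e 1)).add
    ((P 1).hasFDerivAt.smul_const (e 2))

/-- `curl A = V`. -/
theorem curl_Apot (y : E3) : curl Apot y = Vfield y := by
  ext i; fin_cases i <;> simp [curl, (hasFDerivAt_Apot y).fderiv, Vfield, e]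

/-- `χ A = A` near every point of the open unit ball. -/
theorem smul_Apot_eventuallyEq {y : E3} (hy : y ∈ ball (0 : E3) 1) :
    (fun x => χ x • Apot x) =ᶠ[𝓝 y] Apot := by
  filter_upwards [χ.eventuallyEq_one_of_mem_ball (by simpa [χ] using hy)] with x hx
  simp [hx]

/-- The datum equals `V` near the origin. -/
theorem datum_eventuallyEq : datum =ᶠ[𝓝 (0 : E3)] Vfield := by
  filter_upwards [ball_mem_nhds (0 : E3) one_pos] with y hy
  rw [datum, curl_eq_curlCLM, (smul_Apot_eventuallyEq hy).fderiv_eq, ← curl_eq_curlCLM, curl_Apot]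

/-- `u₀(0) = e₀`. -/
theorem datum_zero : datum 0 = e 0 := by rw [datum_eventuallyEq.eq_of_nhds]; simp [Vfield]

/-- `V` has derivative `VL` everywhere. -/
theorem hasFDerivAt_Vfield (y : E3) : HasFDerivAt Vfield VL y := by
  show HasFDerivAt (fun x => e 0 + (P 1 x) • e 2) _ y
  exact ((P 1).hasFDerivAt.smul_const (e 2)).const_add (e 0)

/-- `Du₀(0) = VL`. -/
theorem hasFDerivAt_datum : HasFDerivAt datum VL 0 :=
  (hasFDerivAt_Vfield 0).congr_of_eventuallyEq datum_eventuallyEq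
/-- `∂_j Q₀(0)`: `∂₁ Q₀(0) = k`, the others vanish. -/
theorem pd_datum (j : Fin 3) : pd j (Qf datum) 0 = quatOf (VL (e j)) := pd_Qf hasFDerivAt_datum j
/-- `VL e₀ = 0`. -/
theorem VL_e0 : VL (e 0) = 0 := by simp [VL, e]
/-- `VL e₁ = e₂`. -/
theorem VL_e1 : VL (e 1) = e 2 := by simp [VL, e]
/-- `VL e₂ = 0`. -/
theorem VL_e2 : VL (e 2) = 0 := by simp [VL, e]
/-- **The constraint fails for the datum at the origin:** `Re(Q₀ ⋆ ∇_Q Q₀ + Q̄₀ ⋆ ∇_Q̄ Q₀)(0) = −2`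
(`Q₀(0) = i`, `∇_Q Q₀(0) = j ⋆ k = i`, `∇_Q̄ Q₀(0) = −i`). -/
theorem re_qnonlin_datum : (qnonlin datum 0).re = -2 := by
  simp only [qnonlin, Qf, datum_zero, quatOf_e0, nablaQ, nablaQbar, pd_datum, VL_e0, VL_e1, VL_e2,
    quatOf_e2, quatOf_zero']
  simp [qi, qj, qk]
  norm_num

/-- The datum is smooth. -/
theorem contDiff_datum : ContDiff ℝ ∞ datum :=
  contDiff_curl (n := (⊤ : ℕ∞)) (by exact_mod_cast χ.contDiff.smul contDiff_Apot)
/-- The datum is compactly supported. -/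
theorem hasCompactSupport_datum : HasCompactSupport datum :=
  hasCompactSupport_curl χ.hasCompactSupport.smul_right
/-- The datum is divergence free (`div curl = 0`). -/
theorem isDivFree_datum : NSWave0.IsDivFree datum := by
  intro x
  show VectorCalculus.divergence datum x = 0
  exact divergence_curl_eq_zero_holds _ ((χ.contDiff.smul contDiff_Apot).of_le (by norm_cast)) x

/-- The datum is an `H^s` datum for `s = 3` (indeed every `s`): smooth and compactly supported. -/
theorem hsData_datum : HsData datum := by
  refine hsData_of_hasRapidSpatialDecay contDiff_datum ?_
  intro n K
  have hcont : Continuous fun x => (1 + ‖x‖) ^ K * ‖iteratedFDeriv ℝ n datum x‖ :=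
    ((continuous_const.add continuous_norm).pow K).mul
      (contDiff_datum.continuous_iteratedFDeriv (m := n) (by exact_mod_cast le_top)).norm
  have hsupp : HasCompactSupport fun x => (1 + ‖x‖) ^ K * ‖iteratedFDeriv ℝ n datum x‖ :=
    ((hasCompactSupport_datum.iteratedFDeriv (𝕜 := ℝ) n).norm).mul_left
  obtain ⟨C, hC⟩ := hcont.bddAbove_range_of_hasCompactSupport hsupp
  exact ⟨C, fun x => hC ⟨x, rfl⟩⟩

/-- **Theorem 5.5 (p.13) is false as printed and typed:** for `ν = ρ = 1` and the smooth, compactly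
supported, divergence-free `H^s` datum `u₀ = curl(χ A)` there is NO smooth solution of the quaternionic
system (76)–(77) on `[0, ∞)` with `u(0) = u₀` — the real part of (76) at `t = 0`, `x = 0` would read
`−2 = 0`. (The obstruction is instantaneous: it rules out solutions on any time set containing `0`.) -/
theorem not_Thm55 : ¬ Literature.Claims.NS.Chishtie2025.Thm55 := by
  intro h
  obtain ⟨u, p, hsol, h0⟩ := h 1 1 one_pos one_pos datum contDiff_datum isDivFree_datum hsData_datum
  have hre := re_qnonlin_eq_zero hsol (self_mem_Ici (a := (0 : ℝ))) 0
  rw [h0, re_qnonlin_datum] at hre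
  norm_num at hre

/-- **The claimed theorem (Theorem 5.5 ∧ Corollary 5.6) is false through its FIRST conjunct**, Theorem 5.5
on the quaternionic system (76)–(77). Nothing is asserted here about Corollary 5.6, i.e. about the
Navier–Stokes equations. -/
theorem not_ClaimedTheorem : ¬ Literature.Claims.NS.Chishtie2025.ClaimedTheorem :=
  fun h => not_Thm55 h.1

end Summit.NavierStokesRegularity.NavierStokesRegularity.Theorems.Chishtie2025

end
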